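import Mathlib.Data.Finsupp.Order
import Mathlib.Data.Finsupp.Basic
import Mathlib.Algebra.BigOperators.Group.Finset.Basic
import Mathlib.Data.Fintype.Basic
import HarnessLib

/-!
# Crux `HLiu418`, line LD1 — (Gα-C∞) `ArchLadder`, plate (P5-comb): REACHABILITY COMBINATORICS of torus weights (THEOREMS ONLY)

Cell hodgecm-mathlib, floor 0; seat LD1-p01 (g3); DEALS #12 (2) of LD1-plan (g2); `--supports stmt-HodgeConjecture-24832 --as helper`.
Namespace `Summit.HodgeConjecture.HodgeConjecture.Cruxes.HLiu418.F0LD1ArchLadderReachability`.  Pure `Finsupp` algebra — no theta series,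
no analysis; Mathlib only.

THE POINT.  The Hermite torus weights of the line are `β : κ × o →₀ ℕ` (`κ = Fin n′` coordinates, `o` = the real places of `L⁺`).  A property
`P` of weights (in the application: «the class `[θ_{h_β ⊗ Φ_f}]` lies in the closed invariant subspace `Q`») that is stable under
* the DEFINITE MOVES at every place `v ≠ v₀`: `β ↦ γ` whenever `γ` agrees with `β` off the place-block `κ × {v}` and has the same block total
  `Σ_k γ(k,v) = Σ_k β(k,v)` (the `U(n′)`-mixing of the degree-`d` Fock monomials, A-p16 (g35) ★ `F0LD1ThetaArchCompactStep` + A-p12 (g27) ★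
  `FockRotationCoefficients`), and
* the LADDER MOVES at the place `v₀` of `ι`: `β ↦ β + d` and, when both rungs are positive, `β ↦ β − d`, `d := 𝟙_{(kp,v₀)} + 𝟙_{(km,v₀)}`
  (the `U(1,1)` raising ∕ lowering of the hyperbolic one-parameter group, LD1-p02 (g4) plate (P4)),
propagates from `β` to every `β′` of the SAME TYPE: equal block totals at the definite places, equal INTEGER difference
`β(kp,v₀) − β(km,v₀)` at `v₀`, and agreement at the other coordinates of the `v₀`-block (none when `n′ = 2`).

* `reach_definite` — finite induction over the definite places (one block rewritten at a time: `β′` on the blocks already treated, `β` elsewhere,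
  written with `Finsupp.filter`);
* `reach_up` ∕ `reach_down` — `ℕ`-induction along the ladder (`β + m • d`; on the way down every rung stays positive);
* `reach_of_sameType` — the three combined: the induction principle the HEAD `archLadder_holds` (A-p16 (g35), plate (P5)) consumes;
* `reach_of_sameType_two` — the same for a two-element coordinate type `κ = {k₊, k₋}` (the line's `n′ = 2`), with the definite move spelled on
  the two coordinates of the block (A-p16's (P2c) shape).

HONEST LABEL. HC_CM is proved only modulo the 7 printed citations (2 remaining: hLiu418 = stmt-HodgeConjecture-24832,
h413 = stmt-HodgeConjecture-24833) until rung 0 closes; this file is in-house combinatorics and discharges nothing printed; count-neutral.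
References (prose locators): Folland 1989, Ch. 4, Prop. (4.39) and Thm. (4.37) (the ladder); Kashiwara–Vergne 1978 §6; Howe 1989 §3.
-/

set_option autoImplicit false
set_option linter.dupNamespace false

open scoped BigOperators

namespace Summit.HodgeConjecture.HodgeConjecture.Cruxes.HLiu418.F0LD1ArchLadderReachability

variable {κ o : Type*}

/-! ## §1 The definite places: one block at a time -/

/-- **Definite reachability.**  If `P` is stable under every definite move (rewrite ONE place-block `κ × {v}`, `v ≠ v₀`, keeping its total), then
from `P β` one reaches the weight that agrees with `β′` off the `v₀`-block and with `β` on it, as soon as `β′` has the same block totals as `β` at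
every `v ≠ v₀` (finite induction over the set of treated places, `Finsupp.filter`). [cite: Folland1989, Ch. 4 Prop. (4.39)] -/
theorem reach_definite [Fintype κ] [Fintype o] [DecidableEq o] (P : (κ × o →₀ ℕ) → Prop) (v₀ : o)
    (hdef : ∀ v, v ≠ v₀ → ∀ β γ : κ × o →₀ ℕ, (∀ s, s.2 ≠ v → γ s = β s) →
      ∑ k, γ (k, v) = ∑ k, β (k, v) → P β → P γ)
    {β β' : κ × o →₀ ℕ} (hsum : ∀ v, v ≠ v₀ → ∑ k, β' (k, v) = ∑ k, β (k, v)) (hP : P β) :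
    P (β'.filter (fun s => s.2 ≠ v₀) + β.filter (fun s => s.2 = v₀)) := by
  classical
  -- `F S` := `β′` on the blocks of `S`, `β` elsewhere
  have key : ∀ S : Finset o, S ⊆ Finset.univ.erase v₀ →
      P (β'.filter (fun s => s.2 ∈ S) + β.filter (fun s => s.2 ∉ S)) := by
    intro S
    induction S using Finset.induction_on with
    | empty =>
      intro _
      have h : β'.filter (fun s : κ × o => s.2 ∈ (∅ : Finset o)) + β.filter (fun s : κ × o => s.2 ∉ (∅ : Finset o)) = β := by
        ext s
        simp
      rw [h]
      exact hP
    | insert v S hvS ih =>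
      intro hsub
      have hv : v ≠ v₀ := Finset.ne_of_mem_erase (hsub (Finset.mem_insert_self v S))
      have hS : S ⊆ Finset.univ.erase v₀ := fun w hw => hsub (Finset.mem_insert_of_mem hw)
      refine hdef v hv _ _ (fun s hs => ?_) ?_ (ih hS)
      · -- off the block of `v` nothing changes
        have h1 : (s.2 ∈ insert v S) ↔ (s.2 ∈ S) := by
          rw [Finset.mem_insert]
          exact ⟨fun h => h.resolve_left hs, Or.inr⟩
        simp only [Finsupp.add_apply, Finsupp.filter_apply, h1]
      · -- the block total at `v` is that of `β′`, resp. `β`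
        have hl : ∀ k : κ, (β'.filter (fun s : κ × o => s.2 ∈ insert v S) + β.filter (fun s : κ × o => s.2 ∉ insert v S)) (k, v) = β' (k, v) := by
          intro k
          simp
        have hr : ∀ k : κ, (β'.filter (fun s : κ × o => s.2 ∈ S) + β.filter (fun s : κ × o => s.2 ∉ S)) (k, v) = β (k, v) := by
          intro k
          simp [hvS]
        simp_rw [hl, hr]
        exact hsum v hv
  have hfin := key (Finset.univ.erase v₀) subset_rfl
  have h : β'.filter (fun s : κ × o => s.2 ∈ Finset.univ.erase v₀) + β.filter (fun s : κ × o => s.2 ∉ Finset.univ.erase v₀) =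
      β'.filter (fun s => s.2 ≠ v₀) + β.filter (fun s => s.2 = v₀) := by
    ext s
    simp [Finsupp.filter_apply, Finset.mem_erase]
  rw [h] at hfin
  exact hfin

/-! ## §2 The place of `ι`: up and down the ladder -/

/-- **Up the ladder**: `P β ⇒ P (β + m • d)` when `P` is stable under `β ↦ β + d`. [cite: Folland1989, Ch. 4 Thm. (4.37)] -/
theorem reach_up (P : (κ × o →₀ ℕ) → Prop) (d : κ × o →₀ ℕ) (hup : ∀ β, P β → P (β + d))
    {β : κ × o →₀ ℕ} (hP : P β) (m : ℕ) : P (β + m • d) := by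
  induction m with
  | zero => simpa using hP
  | succ m ih =>
    have h : β + (m + 1) • d = β + m • d + d := by rw [add_smul, one_smul, add_assoc]
    rw [h]
    exact hup _ ih

/-- **Down the ladder**: `P (β′ + m • d) ⇒ P β′` when `P` is stable under `β ↦ β − d` at weights with BOTH rungs `β kp, β km` positive and
`d = 𝟙_{kp} + 𝟙_{km}` (every intermediate rung is positive). [cite: Folland1989, Ch. 4 Thm. (4.37)] -/
theorem reach_down (P : (κ × o →₀ ℕ) → Prop) (kp km : κ × o)
    (hdown : ∀ β : κ × o →₀ ℕ, 0 < β kp → 0 < β km → P β → P (β - (Finsupp.single kp 1 + Finsupp.single km 1)))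
    (m : ℕ) : ∀ {β' : κ × o →₀ ℕ}, P (β' + m • (Finsupp.single kp 1 + Finsupp.single km 1)) → P β' := by
  classical
  induction m with
  | zero => intro β' h; simpa using h
  | succ m ih =>
    intro β' h
    -- `β′ + (m+1) d = (β′ + d) + m d`: first come down to `β′ + d`, then one more rung
    have h1 : β' + (m + 1) • (Finsupp.single kp 1 + Finsupp.single km 1) =
        β' + (Finsupp.single kp 1 + Finsupp.single km 1) + m • (Finsupp.single kp 1 + Finsupp.single km 1) := by
      rw [add_smul, one_smul, add_assoc, add_comm (m • _)]
    rw [h1] at h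
    have h2 := ih h
    have h3 := hdown (β' + (Finsupp.single kp 1 + Finsupp.single km 1))
      (by simp [Finsupp.add_apply, Finsupp.single_apply])
      (by simp [Finsupp.add_apply, Finsupp.single_apply]) h2
    rwa [add_tsub_cancel_right] at h3

/-- **The `ι`-block**: if `P` is stable under `β ↦ β + d` and under `β ↦ β − d` at positive rungs, `d = 𝟙_{kp} + 𝟙_{km}` (`kp ≠ km`), then `P`
passes from `β` to every `β′` agreeing with `β` off `{kp, km}` with the same INTEGER difference `β kp − β km` (stated in `ℕ` as
`β kp + β′ km = β′ kp + β km`). [cite: Folland1989, Ch. 4 Thm. (4.37)] [cite: KashiwaraVergne1978, §6] -/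
theorem reach_iota (P : (κ × o →₀ ℕ) → Prop) (kp km : κ × o) (hk : kp ≠ km)
    (hup : ∀ β : κ × o →₀ ℕ, P β → P (β + (Finsupp.single kp 1 + Finsupp.single km 1)))
    (hdown : ∀ β : κ × o →₀ ℕ, 0 < β kp → 0 < β km → P β → P (β - (Finsupp.single kp 1 + Finsupp.single km 1)))
    {β β' : κ × o →₀ ℕ} (hoff : ∀ s, s ≠ kp → s ≠ km → β' s = β s) (hdiff : β kp + β' km = β' kp + β km) (hP : P β) :
    P β' := by
  classical
  rcases Nat.lt_or_ge (β' kp) (β kp) with hlt | hle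
  · -- down: `β = β′ + m • d`, `m = β kp − β′ kp`
    have h : β = β' + (β kp - β' kp) • (Finsupp.single kp 1 + Finsupp.single km 1) := by
      ext s
      by_cases h₁ : s = kp
      · subst h₁
        simp [Finsupp.add_apply, hk]
        omega
      · by_cases h₂ : s = km
        · subst h₂
          simp [Finsupp.add_apply, hk.symm]
          omega
        · simp [Finsupp.add_apply, Ne.symm h₁, Ne.symm h₂, hoff s h₁ h₂]
    rw [h] at hP
    exact reach_down P kp km hdown _ hP
  · -- up: `β′ = β + m • d`, `m = β′ kp − β kp`
    have h : β' = β + (β' kp - β kp) • (Finsupp.single kp 1 + Finsupp.single km 1) := by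
      ext s
      by_cases h₁ : s = kp
      · subst h₁
        simp [Finsupp.add_apply, hk]
        omega
      · by_cases h₂ : s = km
        · subst h₂
          simp [Finsupp.add_apply, hk.symm]
          omega
        · simp [Finsupp.add_apply, Ne.symm h₁, Ne.symm h₂, hoff s h₁ h₂]
    rw [h]
    exact reach_up P _ hup hP _

/-! ## §3 The induction principle of the head -/

/-- **REACHABILITY WITHIN A TYPE.**  Let `P` be a property of torus weights `β : κ × o →₀ ℕ` stable under (i) the definite moves at every place
`v ≠ v₀` (rewrite the block `κ × {v}` keeping its total) and (ii) the ladder moves `β ↦ β ± d` at `v₀`, `d = 𝟙_{(kp,v₀)} + 𝟙_{(km,v₀)}`, `kp ≠ km`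
(the down-move only at weights with both rungs positive).  Then `P β ⇒ P β′` for every `β′` of the SAME TYPE as `β`: equal block totals at the
definite places, equal integer difference `β(kp,v₀) − β(km,v₀)`, and agreement at the remaining coordinates of the `v₀`-block.
[cite: Folland1989, Ch. 4 Prop. (4.39), Thm. (4.37)] [cite: KashiwaraVergne1978, §6] [cite: Howe1989, §3] -/
theorem reach_of_sameType [Fintype κ] [Fintype o] [DecidableEq o] (P : (κ × o →₀ ℕ) → Prop) (v₀ : o) (kp km : κ)
    (hk : kp ≠ km)
    (hdef : ∀ v, v ≠ v₀ → ∀ β γ : κ × o →₀ ℕ, (∀ s, s.2 ≠ v → γ s = β s) →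
      ∑ k, γ (k, v) = ∑ k, β (k, v) → P β → P γ)
    (hup : ∀ β : κ × o →₀ ℕ, P β → P (β + (Finsupp.single (kp, v₀) 1 + Finsupp.single (km, v₀) 1)))
    (hdown : ∀ β : κ × o →₀ ℕ, 0 < β (kp, v₀) → 0 < β (km, v₀) → P β →
      P (β - (Finsupp.single (kp, v₀) 1 + Finsupp.single (km, v₀) 1)))
    {β β' : κ × o →₀ ℕ} (hsum : ∀ v, v ≠ v₀ → ∑ k, β' (k, v) = ∑ k, β (k, v))
    (hrest : ∀ k, k ≠ kp → k ≠ km → β' (k, v₀) = β (k, v₀))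
    (hdiff : β (kp, v₀) + β' (km, v₀) = β' (kp, v₀) + β (km, v₀)) (hP : P β) : P β' := by
  classical
  -- first the definite places, then the ladder at `v₀`
  have h₁ := reach_definite P v₀ hdef hsum hP
  refine reach_iota P (kp, v₀) (km, v₀) (fun h => hk (Prod.ext_iff.1 h).1) hup hdown (β := _) (β' := β') ?_ ?_ h₁
  · intro s hs₁ hs₂
    by_cases hs : s.2 = v₀
    · obtain ⟨k, w⟩ := s
      simp only at hs
      subst hs
      have hk₁ : k ≠ kp := fun h => hs₁ (by rw [h])
      have hk₂ : k ≠ km := fun h => hs₂ (by rw [h])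
      simp [Finsupp.add_apply, hrest k hk₁ hk₂]
    · simp [Finsupp.add_apply, hs]
  · simpa [Finsupp.add_apply, Finsupp.filter_apply] using hdiff


/-! ## §4 Two coordinates (`n′ = 2`): the shape of the head's steps -/

/-- Over a two-element coordinate type `κ = {k₊, k₋}`, a sum over `κ` is the two-term sum. [folklore: Mathlib `Finset.sum_pair`] -/
theorem sum_eq_add_of_two [Fintype κ] [DecidableEq κ] (kp km : κ) (hk : kp ≠ km) (hcov : ∀ k, k = kp ∨ k = km)
    (f : κ → ℕ) : ∑ k, f k = f kp + f km := by
  have huniv : (Finset.univ : Finset κ) = {kp, km} := by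
    ext k
    simpa using hcov k
  rw [huniv, Finset.sum_pair hk]

/-- **REACHABILITY WITHIN A TYPE, two coordinates** (`κ = {k₊, k₋}`, the line's `Fin n′`, `n′ = 2`): the definite move at `v ≠ v₀` is
«`γ` agrees with `β` off `{(k₊,v), (k₋,v)}` and `γ(k₊,v) + γ(k₋,v) = β(k₊,v) + β(k₋,v)`» (A-p16 (g35) plate (P2c), two `mixU` steps), the ladder
moves at `v₀` are `β ↦ β ± (𝟙_{(k₊,v₀)} + 𝟙_{(k₋,v₀)})` (LD1-p02 (g4) plate (P4)); conclusion: `P β ⇒ P β′` whenever the definite block degrees and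
the integer difference at `v₀` agree. [cite: Folland1989, Ch. 4 Prop. (4.39), Thm. (4.37)] [cite: KashiwaraVergne1978, §6] [cite: Howe1989, §3] -/
theorem reach_of_sameType_two [Fintype κ] [DecidableEq κ] [Fintype o] [DecidableEq o] (P : (κ × o →₀ ℕ) → Prop) (v₀ : o)
    (kp km : κ) (hk : kp ≠ km) (hcov : ∀ k, k = kp ∨ k = km)
    (hdef : ∀ v, v ≠ v₀ → ∀ β γ : κ × o →₀ ℕ, (∀ s, s ≠ (kp, v) → s ≠ (km, v) → γ s = β s) →
      γ (kp, v) + γ (km, v) = β (kp, v) + β (km, v) → P β → P γ)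
    (hup : ∀ β : κ × o →₀ ℕ, P β → P (β + (Finsupp.single (kp, v₀) 1 + Finsupp.single (km, v₀) 1)))
    (hdown : ∀ β : κ × o →₀ ℕ, 0 < β (kp, v₀) → 0 < β (km, v₀) → P β →
      P (β - (Finsupp.single (kp, v₀) 1 + Finsupp.single (km, v₀) 1)))
    {β β' : κ × o →₀ ℕ} (hsum : ∀ v, v ≠ v₀ → β' (kp, v) + β' (km, v) = β (kp, v) + β (km, v))
    (hdiff : β (kp, v₀) + β' (km, v₀) = β' (kp, v₀) + β (km, v₀)) (hP : P β) : P β' := by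
  refine reach_of_sameType P v₀ kp km hk (fun v hv β₁ γ₁ hoff hs hβ₁ => hdef v hv β₁ γ₁ (fun s hs₁ hs₂ => ?_) ?_ hβ₁)
    hup hdown (fun v hv => ?_) (fun k hk₁ hk₂ => ((hcov k).elim (fun h => (hk₁ h).elim) fun h => (hk₂ h).elim)) hdiff hP
  · -- off the two coordinates of the block = off the block
    refine hoff s fun h => ?_
    rcases hcov s.1 with h₁ | h₁
    · exact hs₁ (Prod.ext h₁ h)
    · exact hs₂ (Prod.ext h₁ h)
  · rwa [sum_eq_add_of_two kp km hk hcov, sum_eq_add_of_two kp km hk hcov] at hs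
  · rw [sum_eq_add_of_two kp km hk hcov, sum_eq_add_of_two kp km hk hcov]
    exact hsum v hv

end Summit.HodgeConjecture.HodgeConjecture.Cruxes.HLiu418.F0LD1ArchLadderReachability
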